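import Literature.Computability.Complexity.CodeFPOrderKit
import Literature.Computability.Complexity.CodeFPArith

/-!
# Toolkit stub `toolkit_sortNames` — sorting a raw list of strings by binary value, on codes
# (crux `WbwObfuscatedGluedTrees`, stmt-QuantumAdvantage-2340; line `knowledge-of-walk-split`, stage 3, piece G4 of `NbrBitFP`)

A raw list of bit strings (`rawE strE`) is insertion-sorted by the binary value `bitsToNat` of its items
(least significant bit first — the order `GluedTrees.nameVal` in which the glued-trees oracle lists neighbour
names) by a polynomial-time string function ON CODES (`CodeFP`).  This is the context-free instance of the
tree's `CodeFP.insertionSortCtx` (insertion sort for a relation computed on codes) at the comparison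
`(a, b) ↦ decide (bitsToNat a ≤ bitsToNat b)`, itself `CodeFP.natLe` after `CodeFP.strVal` on both items.
[folklore]
-/

set_option linter.dupNamespace false

namespace Summit.QuantumAdvantage.QuantumAdvantage.Theorems.WbwObfuscatedGluedTrees.KnowledgeOfWalk.Generator

open Literature.Computability.Complexity
open Literature.Computability.Complexity.CodeFP (natE unE bitE pairE strE rawE unitE)

/-- The comparison `bitsToNat a ≤ bitsToNat b` of two strings, with a (unit) context, is computed on codes.
[folklore] -/
private theorem bitsToNatLe_codeFP :
    CodeFP (pairE unitE (pairE strE strE)) bitE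
      (fun t : Unit × List Bool × List Bool => decide (bitsToNat t.2.1 ≤ bitsToNat t.2.2)) :=
  CodeFP.natLe.comp ((CodeFP.strVal.comp (CodeFP.snd _ _).fst').pair (CodeFP.strVal.comp (CodeFP.snd _ _).snd'))

/-- **TOOLKIT G4 — sorting names by binary value on codes**: a raw list of strings is insertion-sorted by
`bitsToNat` (LSB first, the order `GluedTrees.nameVal` of the tree's oracle) by an `FP` string function on
codes. [folklore] -/
theorem toolkit_sortNames :
    Literature.Computability.Complexity.CodeFP (rawE strE) (rawE strE)
      (fun L : List (List Bool) => L.insertionSort fun a b => bitsToNat a ≤ bitsToNat b) := by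
  have h := CodeFP.insertionSortCtx (σ := Unit) (α := List Bool) (eσ := unitE) (eα := strE)
    (r := fun (_ : Unit) (a b : List Bool) => bitsToNat a ≤ bitsToNat b) bitsToNatLe_codeFP
  exact (h.comp ((CodeFP.const (rawE strE) ()).pair (CodeFP.id (rawE strE)))).congr fun _ => rfl

end Summit.QuantumAdvantage.QuantumAdvantage.Theorems.WbwObfuscatedGluedTrees.KnowledgeOfWalk.Generator
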